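import Literature.Computability.Cryptography.PolynomialHashKWise
import Literature.Computability.QuantumComplexity.BoundedIndependenceOracles
import HarnessLib

/-!
# Polynomial-evaluation hashing is a `k`-wise independent family of oracles (tree predicate `IsKWiseIndepFamily`)

Bridge from the finite-field count of `PolynomialHashKWise.lean` to the tree's oracle-family predicate
`Literature.Computability.QuantumComplexity.IsKWiseIndepFamily` (`BoundedIndependenceOracles.lean`): for a finite
field `F` with `k ≤ |F|`, keys of any finite type `K` decoded to coefficient vectors by a map `κ` with uniform
fibres, strings embedded into `F` by a map `ι` injective on the coordinate set `S`, and a balanced output bit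
`φ : F → Bool`, the family `key ↦ {u | φ(P_{κ key}(ι u))}` is `k`-wise independent on `S`. What remains for an
EXPLICIT family in `P` (stub `stub_explicitKWiseHash` of `Cruxes/PromiseTransfer/Lines/birth_PromiseOracleSimulation.lean`)
is a concrete choice of `(F = GF(2^ℓ), ι, κ, φ)` together with a polynomial-time evaluation machine.

* `isKWiseIndepFamily_polyHash` — the statement above.

[cite: WegmanCarter1981, §3] [cite: YamakawaZhandry2022FOCS, Lemma 2.5]
-/

namespace Literature.Computability.Cryptography.PolynomialHash

open Finset Polynomial Literature.Computability.QuantumComplexity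

variable {F : Type*} [Field F] [Fintype F] [DecidableEq F]

/-- **Polynomial hashing is `k`-wise independent** in the sense of the tree's `IsKWiseIndepFamily`: with keys
decoded by a uniform-fibre map `κ : K → (Fin k → F)`, strings embedded by `ι` (injective on `S`), and a balanced
bit `φ`, the family `key ↦ {u | φ(P_{κ key}(ι u)) = true}` is `k`-wise independent on `S` (for `k ≤ |F|`).
[cite: WegmanCarter1981, §3] [cite: YamakawaZhandry2022FOCS, Lemma 2.5] -/
theorem isKWiseIndepFamily_polyHash {K : Type*} [Fintype K] (k : ℕ) (hk : k ≤ Fintype.card F)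
    (κ : K → (Fin k → F)) (d : ℕ) (hκ : ∀ c : Fin k → F, (univ.filter fun key : K => κ key = c).card = d)
    (S : Finset (List Bool)) (ι : List Bool → F) (hι : Set.InjOn ι S)
    (φ : F → Bool) (hφ : 2 * (univ.filter fun x : F => φ x = true).card = Fintype.card F) :
    IsKWiseIndepFamily
      (fun key : K => {u : List Bool |
        φ ((((degreeLTEquiv F k).symm (κ key) : degreeLT F k) : F[X]).eval (ι u)) = true})
      S k := by
  classical
  intro U hUS hUk τ
  -- transport the pattern to the field points `ι '' U`
  have hιU : Set.InjOn ι U := hι.mono (by exact_mod_cast hUS)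
  let UF : Finset F := U.image ι
  have hcard : #UF = #U := Finset.card_image_of_injOn hιU
  -- the pattern on field points: value at `ι u` is `τ u`
  let τF : F → Bool := fun x => if h : ∃ u ∈ U, ι u = x then τ ⟨h.choose, h.choose_spec.1⟩ else false
  have hτF : ∀ u (hu : u ∈ U), τF (ι u) = τ ⟨u, hu⟩ := by
    intro u hu
    have hex : ∃ u' ∈ U, ι u' = ι u := ⟨u, hu, rfl⟩
    simp only [τF, hex, dif_pos]
    have h1 : hex.choose ∈ U := hex.choose_spec.1
    have h2 : ι hex.choose = ι u := hex.choose_spec.2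
    have h3 : hex.choose = u := hιU h1 hu h2
    congr 1
    exact Subtype.ext h3
  -- the bit of the family at a string, as a `decide`
  have hdec : ∀ (key : K) (u : List Bool),
      @decide (u ∈ {u : List Bool |
          φ ((((degreeLTEquiv F k).symm (κ key) : degreeLT F k) : F[X]).eval (ι u)) = true})
        (Classical.propDecidable _) =
        φ ((((degreeLTEquiv F k).symm (κ key) : degreeLT F k) : F[X]).eval (ι u)) := by
    intro key u
    by_cases hb : φ ((((degreeLTEquiv F k).symm (κ key) : degreeLT F k) : F[X]).eval (ι u)) = true
    · rw [hb]
      exact @decide_eq_true _ (Classical.propDecidable _) hb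
    · have hb' : φ ((((degreeLTEquiv F k).symm (κ key) : degreeLT F k) : F[X]).eval (ι u)) = false := by
        simpa using hb
      rw [hb']
      exact @decide_eq_false _ (Classical.propDecidable _) hb
  -- the two key predicates agree
  have hpred : ∀ key : K,
      (restrictBool U {u : List Bool |
          φ ((((degreeLTEquiv F k).symm (κ key) : degreeLT F k) : F[X]).eval (ι u)) = true} = τ) ↔
        ∀ x ∈ UF, φ ((((degreeLTEquiv F k).symm (κ key) : degreeLT F k) : F[X]).eval x) = τF x := by
    intro key
    constructor
    · intro h x hx
      obtain ⟨u, hu, rfl⟩ := mem_image.1 hx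
      have := congrFun h ⟨u, hu⟩
      rw [restrictBool_apply, hdec] at this
      rw [hτF u hu]
      exact this
    · intro h
      funext u'
      obtain ⟨u, hu⟩ := u'
      rw [restrictBool_apply, hdec, ← hτF u hu]
      exact h (ι u) (mem_image_of_mem ι hu)
  have hUFk : #UF ≤ k := by rw [hcard]; exact hUk
  have hmain := card_filter_polyKey_bits_mul_rekey (F := F) k hk κ d hκ UF hUFk τF φ hφ
  rw [hcard] at hmain
  convert hmain using 3
  ext key
  simp only [mem_filter, mem_univ, true_and]
  exact hpred key

end Literature.Computability.Cryptography.PolynomialHash
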